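import Literature.MathematicalPhysics.QuantumFieldTheory.Balaban1983to89.B9Eq3152ThirdWordPiGradRowOfHolderLetters
import Literature.MathematicalPhysics.QuantumFieldTheory.Balaban1983to89.B9Eq340WeightedHolderRowsProjectionStep
import Literature.MathematicalPhysics.QuantumFieldTheory.Balaban1983to89.B9Eq325ProjFormulaTower

/-!
# `Balaban1983to89.B9Eq3152RkStepHolderLetterExplicit` — T. Bałaban, *Propagators for lattice gauge theories in a background field*, Commun. Math. Phys. **99** (1985) 389–434
# [Balaban1985BackgroundPropagators] (3.25) p. 394, Thm 3.1 (3.42)–(3.43) pp. 397–398: **THE `R_k`-STEP OF THE HÖLDER LETTER WITH THE EXPONENT EXPLICIT** — the tree's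
# `B9Eq3152RkStepHolderLetterDocking.holderLetter_RkGpDstar_of_GpDstar` ((HLa) ⇐ (HLa₀) ∧ (HX): the weighted value ∕ η-scale Hölder rows of `ω = R_kG′_kD*_Uf` from those of
# `G′_kD*_Uf` and the two sup-currency letters of `X_k`, `R_k = I − X_k`) packages the Hölder exponent existentially (`∃ ε …` in, `∃ ε …` out), which makes the exponent
# OPAQUE to a consumer; this lineage's rows route to STOREY H's `H3` (`B9Eq3152ThirdWordGradRowOfHessianRows`) needs the exponent `½`.  This file is the SAME theorem and
# proof with `ε` a parameter.  NE9 crux-team LEAF PROVER 01, gen 95.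

statement-level skeleton of published theorems with citation tags; proofs where landed; nothing here is a claim about the Yang–Mills mass gap

CITATION HEADER (lean-in-tree rule).  Audit cell `pub-balaban`, sub-cell `t4`, BINDER row NE9; filed by NE9 crux-team LEAF PROVER 01 (`b2b-balaban-t4-ne9-formalise-leaf-01`,
gen 95; bears_on: R4/N22).  Source READ first-hand (`paper:balaban1985-cmp99-background-propagators`, pp. 394, 397–398).  PROOF: verbatim the tree's (HJ-4
`B9Eq340WeightedHolderRowsProjectionStep.weightedHolderRows_sub_of_localLetters` at the tower, `B9Eq325ProjFormulaTower.RofUk_eq_formula_of_unitary`).  Nothing printed is a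
hypothesis.

WHAT IS PROVED (sorry-free; proof lane — 0 `def`).  **`holderLetter_RkGpDstar_of_GpDstar_explicit`** — for `ε ≤ 1`: (HLa₀ with exponent ε) ∧ (HX) ⟹ (HLa with exponent ε).
HONEST SCOPE.  A re-packaging of a LANDED junction; nothing of print's Thm 3.1 on print's objects is asserted; «NE9 ⇐ the named binders»; NE9 NOT PRINTED ∕ NOT PROVED; row WALLED ON A
MODEL (O-NE9-1; #5 UNRULED); spine PROVED 0∕9; rung (B)+1 on a finite T⁴ — NOT infinite volume, NOT mass gap, NOT BetaPertH, NOT Clay.  NEW file; nothing modified.  Net new unproved facts: 0.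
-/

noncomputable section

open scoped InnerProductSpace ComplexConjugate BigOperators

namespace Literature.MathematicalPhysics.QuantumFieldTheory.Balaban1983to89.B9Eq3152RkStepHolderLetterExplicit


open B4Sect5Torus (TSite tdist tdist_nonneg tdist_triangle tdist_symm torusSum_le)
open B4Sect5Proof (latticeConst latticeConst_nonneg)
open B9SectCLatticeCarrier (Bond bpos btgt unshift)
open B9Eq311L2Pairing (WL2)
open B9Eq33CovDerivVector (covDeriv)
open B9Eq319QprimeTorus (fineP blockCoord)
open B7Prop1Explicit (U1 Wcx boxVec)
open B11Eq103H1Complex (SiteL2K BondL2K covDerivL2K covDivL2K G1LatticeK greenK equiv_covDerivL2K)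
open B9Eq310DeltaPrime (plaqHolU)
open B9Eq310HessianOperator (adTransportW hessOp)
open B9Eq315QTorus (perCfg cornerSite)
open B9Eq315QTower (towerP UlevOf)
open B9Eq316TowerFlatIsOneStep (towerP_eq_fineP_pow siteCast)
open B9Eq326OperatorTower (QprimeTowerW QkW RofUk laplaceAk G1k)
open B9Eq324DeltaPrimeATower (laplacePrimeAk GpOfUk)
open B9Eq3119DeltaPiTower (piOfUk laplaceAkPi)
open B9Eq325ProjFormulaTower (QGGQk_pos_of_unitary RofUk_eq_formula_of_unitary)
open B9Eq340WeightedHolderRowsProjectionStep (weightedHolderRows_sub_of_localLetters)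

variable {d : ℕ} (L : ℕ) [NeZero L] (hL : 1 ≤ L)
  {𝔸 : Type*} [NormedRing 𝔸] [NormedAlgebra ℂ 𝔸] [CompleteSpace 𝔸] [NormOneClass 𝔸] [StarRing 𝔸] [StarModule ℂ 𝔸]
  {W : Type*} [NormedAddCommGroup W] [InnerProductSpace ℂ W] [FiniteDimensional ℂ W] (φ : W ≃ₗ[ℂ] 𝔸)
  {Mφ Mφ' : ℝ} (hMφ : 0 ≤ Mφ) (hMφ' : 0 ≤ Mφ') (hφ : ∀ w, ‖φ w‖ ≤ Mφ * ‖w‖) (hφ' : ∀ X, ‖φ.symm X‖ ≤ Mφ' * ‖X‖)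
  {a : ℝ} {a' : ℝ} {ϱ : ℝ}
  (τ : 𝔸 →ₗ[ℂ] ℂ) {ρw : ℝ}
  (hτ₁ : ∀ X : 𝔸, τ (star X) = conj (τ X)) (hτ₂ : ∀ X Y : 𝔸, τ (X * Y) = τ (Y * X)) (hφτ : ∀ X Y : 𝔸, ⟪φ.symm X, φ.symm Y⟫_ℂ = τ (star X * Y))
  (AQ : ℝ)

set_option maxHeartbeats 800000 in -- three ≈ 50-binder blocks
include hL hMφ hMφ' hφ hφ' in
/-- **(HLa) FROM (HLa₀) ∧ (HX), THE HÖLDER EXPONENT `ε` KEPT EXPLICIT** (verbatim the tree's `B9Eq3152RkStepHolderLetterDocking.holderLetter_RkGpDstar_of_GpDstar` with `ε` a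
parameter instead of an existential witness — needed by the rows route to `H3`, which consumes the exponent `½`). — the weighted value ∕ η-scale Hölder rows of `ω = R_kG′_kD*_Uf` from those of `ν = G′_kD*_Uf` ((3.43)₂) and the two
sup-currency letters of `X_k = G′_kQ̃′_k†c_kQ̃′_kG′_k` ((3.25): `R_k = I − X_k`), by (HJ-4) `weightedHolderRows_sub_of_localLetters` at the tower. [folklore]
[cite: Balaban1985BackgroundPropagators, (3.25) p.394, Thm 3.1 (3.42)–(3.43) pp.397–398, (3.47) p.398, (3.40) p.397] -/
theorem holderLetter_RkGpDstar_of_GpDstar_explicit {ε : ℝ} (hε1 : ε ≤ 1)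
    (HLa₀ : ∃ αa Ba δa : ℝ, 0 < αa ∧ 0 ≤ Ba ∧ 0 < δa ∧
      ∀ (n : ℕ) (η : ℝ) (_hηL : η * (L : ℝ) ^ (n + 1) = 1) (c₀ c₁ : ℝ) [Fact (0 < c₀)] [Fact (0 < c₁)]
        (_hw : c₀ * ((L : ℝ) ^ (n + 1)) ^ d = c₁) (_hρ : |η| ^ d / c₀ ≤ ρw) (m : Fin d → ℕ) [∀ i, NeZero (m i)] (_hm : ∀ i, 1 ≤ m i)
        (U : Bond d (towerP L m (n + 1)) → 𝔸ˣ) (αU : ℕ → ℝ) (_hα0 : ∀ j, 0 ≤ αU j) (hα1 : ∀ j, αU j ≤ 1 / 64)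
        (hU1 : ∀ (j : ℕ) (x : B7Prop1Explicit.Site d) (k : Fin d), perCfg (towerP L m (j + 1)) (UlevOf L m (n + 1) U j) x k ∈ U1 𝔸)
        (hreg : ∀ (j : ℕ) (y : TSite d (towerP L m j)) (k : Fin d) (ρ' : Fin d → Fin L),
          ‖((Wcx L (perCfg (towerP L m (j + 1)) (UlevOf L m (n + 1) U j)) (cornerSite L y) k (boxVec L ρ') : 𝔸ˣ) : 𝔸) - 1‖ ≤ αU j)
        (εU : ℕ → ℝ) (_hεU : ∀ j, 0 ≤ εU j) (_hUε : ∀ (j : ℕ) (b : Bond d (towerP L m (j + 1))), ‖(UlevOf L m (n + 1) U j b : 𝔸) - 1‖ ≤ εU j)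
        (_hLb : ∀ (j : ℕ) (b : Bond d (towerP L m (j + 1))), UlevOf L m (n + 1) U j b ∈ U1 𝔸)
        (α : ℝ) (_hα : 0 ≤ α) (_hαle : α ≤ αa)
        (hUst : ∀ b, star (U b : 𝔸) = (((U b)⁻¹ : 𝔸ˣ) : 𝔸)) (_hUb : ∀ b, U b ∈ U1 𝔸) (_hUη : ∀ b, ‖(U b : 𝔸) - 1‖ ≤ α * η)
        (_hpl : ∀ p : B9SectCLatticeCarrier.Plaq d (towerP L m (n + 1)), ‖(plaqHolU U p : 𝔸) - 1‖ ≤ α * η ^ 2)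
        (_hUgrad : ∀ (x : TSite d (towerP L m (n + 1))) (μ : Fin d), ‖(U (x, μ) : 𝔸) - U (unshift μ x, μ)‖ ≤ α * η ^ 2)
        (_hRlev : ∀ (j : ℕ) (b : Bond d (towerP L m (j + 1))) (w : W), ‖adTransportW φ (UlevOf L m (n + 1) U j) b w‖ ≤ ‖w‖)
        (_hεg : ∀ j < n + 1, εU j ≤ α * ϱ ^ j) (_hAQ : ∑ j ∈ Finset.range (n + 1), αU j ≤ AQ)
        (hpos' : ∀ x : SiteL2K ℂ d (towerP L m (n + 1)) c₀ W, x ≠ 0 → 0 < RCLike.re ⟪x, laplacePrimeAk L m n φ η U a' (c₁ := c₁) x⟫_ℂ)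
        (hpos : ∀ x : BondL2K ℂ d (towerP L m (n + 1)) c₀ W, x ≠ 0 →
          0 < RCLike.re ⟪x, laplaceAk L m n φ η U hL αU hα1 hU1 hreg τ (c₀ := c₀) (c₁ := c₁) a x⟫_ℂ)
        (hposπ : ∀ x : BondL2K ℂ d (towerP L m (n + 1)) c₀ W, x ≠ 0 →
          0 < RCLike.re ⟪x, laplaceAkPi L m n φ τ η U a' hpos' hL αU hα1 hU1 hreg (c₁ := c₁) a x⟫_ℂ)
        (_hc₀ : c₀ = η ^ d)
        (_hJ : ∀ (μ : Fin d) (y : TSite d (towerP L m (n + 1))),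
          ‖B9Eq39Adjoint.J (fun μ => B9Eq33CovDerivVector.shiftEquiv μ) (fun μ y => U (y, μ)) η μ y‖ ≤ α)
        (v : TSite d m) (f : BondL2K ℂ d (towerP L m (n + 1)) c₀ W) (F : ℝ)
        (_hfv : ∀ b, blockCoord (L ^ (n + 1)) m (siteCast (towerP_eq_fineP_pow L m (n + 1)) (bpos b)) ≠ v →
          WL2.equiv ℂ (fun _ : Bond d (towerP L m (n + 1)) => c₀) W f b = 0)
        (_hfF : ∀ b, ‖WL2.equiv ℂ (fun _ : Bond d (towerP L m (n + 1)) => c₀) W f b‖ ≤ F) (x : TSite d (towerP L m (n + 1))),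
        ‖WL2.equiv ℂ (fun _ : TSite d (towerP L m (n + 1)) => c₀) W (GpOfUk L m n φ η U a' (c₁ := c₁) hpos' (covDivL2K ℂ c₀ ((η : ℂ))⁻¹ (adTransportW φ fun bb => (U bb)⁻¹) f)) x‖ ≤
          Ba * Real.exp (-(δa * tdist m (blockCoord (L ^ (n + 1)) m (siteCast (towerP_eq_fineP_pow L m (n + 1)) x)) v)) * F ∧
        ∀ x' : TSite d (towerP L m (n + 1)), tdist (towerP L m (n + 1)) x x' ≤ ((L ^ (n + 1) : ℕ) : ℝ) →
          ‖WL2.equiv ℂ (fun _ : TSite d (towerP L m (n + 1)) => c₀) W (GpOfUk L m n φ η U a' (c₁ := c₁) hpos' (covDivL2K ℂ c₀ ((η : ℂ))⁻¹ (adTransportW φ fun bb => (U bb)⁻¹) f)) x' - WL2.equiv ℂ (fun _ : TSite d (towerP L m (n + 1)) => c₀) W (GpOfUk L m n φ η U a' (c₁ := c₁) hpos' (covDivL2K ℂ c₀ ((η : ℂ))⁻¹ (adTransportW φ fun bb => (U bb)⁻¹) f)) x‖ ≤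
            Ba * Real.exp (-(δa * tdist m (blockCoord (L ^ (n + 1)) m (siteCast (towerP_eq_fineP_pow L m (n + 1)) x)) v)) * (tdist (towerP L m (n + 1)) x x' / ((L ^ (n + 1) : ℕ) : ℝ)) ^ ε * F)
    (HX : ∃ αx Bx κx : ℝ, 0 < αx ∧ 0 ≤ Bx ∧ 0 < κx ∧
      ∀ (n : ℕ) (η : ℝ) (_hηL : η * (L : ℝ) ^ (n + 1) = 1) (c₀ c₁ : ℝ) [Fact (0 < c₀)] [Fact (0 < c₁)]
        (_hw : c₀ * ((L : ℝ) ^ (n + 1)) ^ d = c₁) (_hρ : |η| ^ d / c₀ ≤ ρw) (m : Fin d → ℕ) [∀ i, NeZero (m i)] (_hm : ∀ i, 1 ≤ m i)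
        (U : Bond d (towerP L m (n + 1)) → 𝔸ˣ) (αU : ℕ → ℝ) (_hα0 : ∀ j, 0 ≤ αU j) (hα1 : ∀ j, αU j ≤ 1 / 64)
        (hU1 : ∀ (j : ℕ) (x : B7Prop1Explicit.Site d) (k : Fin d), perCfg (towerP L m (j + 1)) (UlevOf L m (n + 1) U j) x k ∈ U1 𝔸)
        (hreg : ∀ (j : ℕ) (y : TSite d (towerP L m j)) (k : Fin d) (ρ' : Fin d → Fin L),
          ‖((Wcx L (perCfg (towerP L m (j + 1)) (UlevOf L m (n + 1) U j)) (cornerSite L y) k (boxVec L ρ') : 𝔸ˣ) : 𝔸) - 1‖ ≤ αU j)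
        (εU : ℕ → ℝ) (_hεU : ∀ j, 0 ≤ εU j) (_hUε : ∀ (j : ℕ) (b : Bond d (towerP L m (j + 1))), ‖(UlevOf L m (n + 1) U j b : 𝔸) - 1‖ ≤ εU j)
        (_hLb : ∀ (j : ℕ) (b : Bond d (towerP L m (j + 1))), UlevOf L m (n + 1) U j b ∈ U1 𝔸)
        (α : ℝ) (_hα : 0 ≤ α) (_hαle : α ≤ αx)
        (hUst : ∀ b, star (U b : 𝔸) = (((U b)⁻¹ : 𝔸ˣ) : 𝔸)) (_hUb : ∀ b, U b ∈ U1 𝔸) (_hUη : ∀ b, ‖(U b : 𝔸) - 1‖ ≤ α * η)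
        (_hpl : ∀ p : B9SectCLatticeCarrier.Plaq d (towerP L m (n + 1)), ‖(plaqHolU U p : 𝔸) - 1‖ ≤ α * η ^ 2)
        (_hUgrad : ∀ (x : TSite d (towerP L m (n + 1))) (μ : Fin d), ‖(U (x, μ) : 𝔸) - U (unshift μ x, μ)‖ ≤ α * η ^ 2)
        (_hRlev : ∀ (j : ℕ) (b : Bond d (towerP L m (j + 1))) (w : W), ‖adTransportW φ (UlevOf L m (n + 1) U j) b w‖ ≤ ‖w‖)
        (_hεg : ∀ j < n + 1, εU j ≤ α * ϱ ^ j) (_hAQ : ∑ j ∈ Finset.range (n + 1), αU j ≤ AQ)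
        (hpos' : ∀ x : SiteL2K ℂ d (towerP L m (n + 1)) c₀ W, x ≠ 0 → 0 < RCLike.re ⟪x, laplacePrimeAk L m n φ η U a' (c₁ := c₁) x⟫_ℂ)
        (hpos : ∀ x : BondL2K ℂ d (towerP L m (n + 1)) c₀ W, x ≠ 0 →
          0 < RCLike.re ⟪x, laplaceAk L m n φ η U hL αU hα1 hU1 hreg τ (c₀ := c₀) (c₁ := c₁) a x⟫_ℂ)
        (hposπ : ∀ x : BondL2K ℂ d (towerP L m (n + 1)) c₀ W, x ≠ 0 →
          0 < RCLike.re ⟪x, laplaceAkPi L m n φ τ η U a' hpos' hL αU hα1 hU1 hreg (c₁ := c₁) a x⟫_ℂ)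
        (_hc₀ : c₀ = η ^ d)
        (_hJ : ∀ (μ : Fin d) (y : TSite d (towerP L m (n + 1))),
          ‖B9Eq39Adjoint.J (fun μ => B9Eq33CovDerivVector.shiftEquiv μ) (fun μ y => U (y, μ)) η μ y‖ ≤ α)
        (v' : TSite d m) (w : SiteL2K ℂ d (towerP L m (n + 1)) c₀ W) (F : ℝ)
        (_hwv : ∀ x, blockCoord (L ^ (n + 1)) m (siteCast (towerP_eq_fineP_pow L m (n + 1)) x) ≠ v' → WL2.equiv ℂ (fun _ : TSite d (towerP L m (n + 1)) => c₀) W w x = 0)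
        (_hwF : ∀ x, ‖WL2.equiv ℂ (fun _ : TSite d (towerP L m (n + 1)) => c₀) W w x‖ ≤ F),
        (∀ x : TSite d (towerP L m (n + 1)), ‖WL2.equiv ℂ (fun _ : TSite d (towerP L m (n + 1)) => c₀) W (GpOfUk L m n φ η U a' (c₁ := c₁) hpos' (LinearMap.adjoint ((WL2.linearEquiv ℂ ℂ (fun _ : TSite d m => c₁)).symm.toLinearMap ∘ₗ QprimeTowerW L m n φ U (c₀ := c₀)) (greenK _ (QGGQk_pos_of_unitary L m n φ c₀ η U c₁ a' τ hτ₂ hφτ hUst hpos') (((WL2.linearEquiv ℂ ℂ (fun _ : TSite d m => c₁)).symm.toLinearMap ∘ₗ QprimeTowerW L m n φ U (c₀ := c₀)) (GpOfUk L m n φ η U a' (c₁ := c₁) hpos' w))))) x‖ ≤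
          Bx * Real.exp (-(κx * tdist m (blockCoord (L ^ (n + 1)) m (siteCast (towerP_eq_fineP_pow L m (n + 1)) x)) v')) * F) ∧
        (∀ b : Bond d (towerP L m (n + 1)), ‖WL2.equiv ℂ (fun _ : Bond d (towerP L m (n + 1)) => c₀) W (covDerivL2K ℂ c₀ ((η : ℂ))⁻¹ (adTransportW φ U) (GpOfUk L m n φ η U a' (c₁ := c₁) hpos' (LinearMap.adjoint ((WL2.linearEquiv ℂ ℂ (fun _ : TSite d m => c₁)).symm.toLinearMap ∘ₗ QprimeTowerW L m n φ U (c₀ := c₀)) (greenK _ (QGGQk_pos_of_unitary L m n φ c₀ η U c₁ a' τ hτ₂ hφτ hUst hpos') (((WL2.linearEquiv ℂ ℂ (fun _ : TSite d m => c₁)).symm.toLinearMap ∘ₗ QprimeTowerW L m n φ U (c₀ := c₀)) (GpOfUk L m n φ η U a' (c₁ := c₁) hpos' w)))))) b‖ ≤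
          Bx * Real.exp (-(κx * tdist m (blockCoord (L ^ (n + 1)) m (siteCast (towerP_eq_fineP_pow L m (n + 1)) (bpos b))) v')) * F)) :
    ∃ αa Ba δa : ℝ, 0 < αa ∧ 0 ≤ Ba ∧ 0 < δa ∧
      ∀ (n : ℕ) (η : ℝ) (_hηL : η * (L : ℝ) ^ (n + 1) = 1) (c₀ c₁ : ℝ) [Fact (0 < c₀)] [Fact (0 < c₁)]
        (_hw : c₀ * ((L : ℝ) ^ (n + 1)) ^ d = c₁) (_hρ : |η| ^ d / c₀ ≤ ρw) (m : Fin d → ℕ) [∀ i, NeZero (m i)] (_hm : ∀ i, 1 ≤ m i)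
        (U : Bond d (towerP L m (n + 1)) → 𝔸ˣ) (αU : ℕ → ℝ) (_hα0 : ∀ j, 0 ≤ αU j) (hα1 : ∀ j, αU j ≤ 1 / 64)
        (hU1 : ∀ (j : ℕ) (x : B7Prop1Explicit.Site d) (k : Fin d), perCfg (towerP L m (j + 1)) (UlevOf L m (n + 1) U j) x k ∈ U1 𝔸)
        (hreg : ∀ (j : ℕ) (y : TSite d (towerP L m j)) (k : Fin d) (ρ' : Fin d → Fin L),
          ‖((Wcx L (perCfg (towerP L m (j + 1)) (UlevOf L m (n + 1) U j)) (cornerSite L y) k (boxVec L ρ') : 𝔸ˣ) : 𝔸) - 1‖ ≤ αU j)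
        (εU : ℕ → ℝ) (_hεU : ∀ j, 0 ≤ εU j) (_hUε : ∀ (j : ℕ) (b : Bond d (towerP L m (j + 1))), ‖(UlevOf L m (n + 1) U j b : 𝔸) - 1‖ ≤ εU j)
        (_hLb : ∀ (j : ℕ) (b : Bond d (towerP L m (j + 1))), UlevOf L m (n + 1) U j b ∈ U1 𝔸)
        (α : ℝ) (_hα : 0 ≤ α) (_hαle : α ≤ αa)
        (hUst : ∀ b, star (U b : 𝔸) = (((U b)⁻¹ : 𝔸ˣ) : 𝔸)) (_hUb : ∀ b, U b ∈ U1 𝔸) (_hUη : ∀ b, ‖(U b : 𝔸) - 1‖ ≤ α * η)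
        (_hpl : ∀ p : B9SectCLatticeCarrier.Plaq d (towerP L m (n + 1)), ‖(plaqHolU U p : 𝔸) - 1‖ ≤ α * η ^ 2)
        (_hUgrad : ∀ (x : TSite d (towerP L m (n + 1))) (μ : Fin d), ‖(U (x, μ) : 𝔸) - U (unshift μ x, μ)‖ ≤ α * η ^ 2)
        (_hRlev : ∀ (j : ℕ) (b : Bond d (towerP L m (j + 1))) (w : W), ‖adTransportW φ (UlevOf L m (n + 1) U j) b w‖ ≤ ‖w‖)
        (_hεg : ∀ j < n + 1, εU j ≤ α * ϱ ^ j) (_hAQ : ∑ j ∈ Finset.range (n + 1), αU j ≤ AQ)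
        (hpos' : ∀ x : SiteL2K ℂ d (towerP L m (n + 1)) c₀ W, x ≠ 0 → 0 < RCLike.re ⟪x, laplacePrimeAk L m n φ η U a' (c₁ := c₁) x⟫_ℂ)
        (hpos : ∀ x : BondL2K ℂ d (towerP L m (n + 1)) c₀ W, x ≠ 0 →
          0 < RCLike.re ⟪x, laplaceAk L m n φ η U hL αU hα1 hU1 hreg τ (c₀ := c₀) (c₁ := c₁) a x⟫_ℂ)
        (hposπ : ∀ x : BondL2K ℂ d (towerP L m (n + 1)) c₀ W, x ≠ 0 →
          0 < RCLike.re ⟪x, laplaceAkPi L m n φ τ η U a' hpos' hL αU hα1 hU1 hreg (c₁ := c₁) a x⟫_ℂ)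
        (_hc₀ : c₀ = η ^ d)
        (_hJ : ∀ (μ : Fin d) (y : TSite d (towerP L m (n + 1))),
          ‖B9Eq39Adjoint.J (fun μ => B9Eq33CovDerivVector.shiftEquiv μ) (fun μ y => U (y, μ)) η μ y‖ ≤ α)
        (v : TSite d m) (f : BondL2K ℂ d (towerP L m (n + 1)) c₀ W) (F : ℝ)
        (_hfv : ∀ b, blockCoord (L ^ (n + 1)) m (siteCast (towerP_eq_fineP_pow L m (n + 1)) (bpos b)) ≠ v →
          WL2.equiv ℂ (fun _ : Bond d (towerP L m (n + 1)) => c₀) W f b = 0)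
        (_hfF : ∀ b, ‖WL2.equiv ℂ (fun _ : Bond d (towerP L m (n + 1)) => c₀) W f b‖ ≤ F) (x : TSite d (towerP L m (n + 1))),
        ‖WL2.equiv ℂ (fun _ : TSite d (towerP L m (n + 1)) => c₀) W (RofUk L m n φ η U (GpOfUk L m n φ η U a' (c₁ := c₁) hpos' (covDivL2K ℂ c₀ ((η : ℂ))⁻¹ (adTransportW φ fun bb => (U bb)⁻¹) f))) x‖ ≤
          Ba * Real.exp (-(δa * tdist m (blockCoord (L ^ (n + 1)) m (siteCast (towerP_eq_fineP_pow L m (n + 1)) x)) v)) * F ∧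
        ∀ x' : TSite d (towerP L m (n + 1)), tdist (towerP L m (n + 1)) x x' ≤ ((L ^ (n + 1) : ℕ) : ℝ) →
          ‖WL2.equiv ℂ (fun _ : TSite d (towerP L m (n + 1)) => c₀) W (RofUk L m n φ η U (GpOfUk L m n φ η U a' (c₁ := c₁) hpos' (covDivL2K ℂ c₀ ((η : ℂ))⁻¹ (adTransportW φ fun bb => (U bb)⁻¹) f))) x' - WL2.equiv ℂ (fun _ : TSite d (towerP L m (n + 1)) => c₀) W (RofUk L m n φ η U (GpOfUk L m n φ η U a' (c₁ := c₁) hpos' (covDivL2K ℂ c₀ ((η : ℂ))⁻¹ (adTransportW φ fun bb => (U bb)⁻¹) f))) x‖ ≤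
            Ba * Real.exp (-(δa * tdist m (blockCoord (L ^ (n + 1)) m (siteCast (towerP_eq_fineP_pow L m (n + 1)) x)) v)) * (tdist (towerP L m (n + 1)) x x' / ((L ^ (n + 1) : ℕ) : ℝ)) ^ ε * F := by
  classical
  obtain ⟨αa, Ba, δa, hαa, hBa, hδa, HA⟩ := HLa₀
  obtain ⟨αx, Bx, κx, hαx, hBx, hκx, HXk⟩ := HX
  obtain ⟨δ₂, hδ₂d⟩ : ∃ δ₂ : ℝ, δ₂ = min δa (κx / 2) := ⟨_, rfl⟩
  have hδ₂0 : 0 < δ₂ := by rw [hδ₂d]; exact lt_min hδa (half_pos hκx)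
  have hδ₂κ : δ₂ < κx := by rw [hδ₂d]; exact (min_le_right _ _).trans_lt (half_lt_self hκx)
  have hKc : 0 ≤ latticeConst d (κx - δ₂) := latticeConst_nonneg d (by linarith)
  obtain ⟨C, hC⟩ : ∃ C : ℝ, C = Ba + Bx * latticeConst d (κx - δ₂) * Ba +
      d * (Bx * latticeConst d (κx - δ₂) * Ba + 2 * Mφ * Mφ' * (min αa αx) * (Bx * latticeConst d (κx - δ₂) * Ba)) * Real.exp δ₂ := ⟨_, rfl⟩
  have hC0 : 0 ≤ C := by rw [hC]; have := (lt_min hαa hαx).le; positivity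
  refine ⟨min αa αx, C, δ₂, lt_min hαa hαx, hC0, hδ₂0, ?_⟩
  intro n η hηL c₀ c₁ _ _ hw hρ m _ hm U αU hα0 hα1 hU1 hreg εU hεU hUε hLb α hα hαle hUst hUb hUη hpl hUgrad hRlev hεg hAQ hpos' hpos hposπ hc₀ hJ v f F hfv hfF x
  have hαa' : α ≤ αa := hαle.trans (min_le_left _ _)
  have hαx' : α ≤ αx := hαle.trans (min_le_right _ _)
  haveI : NeZero (L ^ (n + 1)) := ⟨pow_ne_zero _ (NeZero.ne L)⟩
  have hη : 0 < η := by
    have hLp : (0 : ℝ) < (L : ℝ) ^ (n + 1) := pow_pos (Nat.cast_pos.2 hL) _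
    by_contra h
    have : η * (L : ℝ) ^ (n + 1) ≤ 0 := mul_nonpos_of_nonpos_of_nonneg (not_lt.mp h) hLp.le
    linarith only [this, hηL]
  have hηK : η * (((L ^ (n + 1) : ℕ)) : ℝ) = 1 := by push_cast; exact hηL
  have HAk := HA n η hηL c₀ c₁ hw hρ m hm U αU hα0 hα1 hU1 hreg εU hεU hUε hLb α hα hαa' hUst hUb hUη hpl hUgrad hRlev hεg hAQ hpos' hpos hposπ hc₀ hJ v f F hfv hfF
  have hBaF : 0 ≤ Ba * F := by
    have h1 := (norm_nonneg _).trans (HAk x).1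
    have h2 : 0 < Real.exp (-(δa * tdist m (blockCoord (L ^ (n + 1)) m (siteCast (towerP_eq_fineP_pow L m (n + 1)) x)) v)) := Real.exp_pos _
    nlinarith
  have HXk' := HXk n η hηL c₀ c₁ hw hρ m hm U αU hα0 hα1 hU1 hreg εU hεU hUε hLb α hα hαx' hUst hUb hUη hpl hUgrad hRlev hεg hAQ hpos' hpos hposπ hc₀ hJ
  -- `X` read on the site functions
  obtain ⟨X, hX⟩ : ∃ X : (TSite d (towerP L m (n + 1)) → W) →ₗ[ℂ] (TSite d (towerP L m (n + 1)) → W), ∀ g y, X g y =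
      WL2.equiv ℂ (fun _ : TSite d (towerP L m (n + 1)) => c₀) W (GpOfUk L m n φ η U a' (c₁ := c₁) hpos' (LinearMap.adjoint ((WL2.linearEquiv ℂ ℂ (fun _ : TSite d m => c₁)).symm.toLinearMap ∘ₗ QprimeTowerW L m n φ U (c₀ := c₀)) (greenK _ (QGGQk_pos_of_unitary L m n φ c₀ η U c₁ a' τ hτ₂ hφτ hUst hpos') (((WL2.linearEquiv ℂ ℂ (fun _ : TSite d m => c₁)).symm.toLinearMap ∘ₗ QprimeTowerW L m n φ U (c₀ := c₀)) (GpOfUk L m n φ η U a' (c₁ := c₁) hpos' ((WL2.equiv ℂ (fun _ : TSite d (towerP L m (n + 1)) => c₀) W).symm g)))))) y :=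
    ⟨(WL2.linearEquiv ℂ ℂ (fun _ : TSite d (towerP L m (n + 1)) => c₀)).toLinearMap ∘ₗ
      (GpOfUk L m n φ η U a' (c₁ := c₁) hpos' ∘ₗ LinearMap.adjoint ((WL2.linearEquiv ℂ ℂ (fun _ : TSite d m => c₁)).symm.toLinearMap ∘ₗ QprimeTowerW L m n φ U (c₀ := c₀)) ∘ₗ
        (greenK _ (QGGQk_pos_of_unitary L m n φ c₀ η U c₁ a' τ hτ₂ hφτ hUst hpos')) ∘ₗ ((WL2.linearEquiv ℂ ℂ (fun _ : TSite d m => c₁)).symm.toLinearMap ∘ₗ QprimeTowerW L m n φ U (c₀ := c₀)) ∘ₗ GpOfUk L m n φ η U a' (c₁ := c₁) hpos') ∘ₗ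
      (WL2.linearEquiv ℂ ℂ (fun _ : TSite d (towerP L m (n + 1)) => c₀)).symm.toLinearMap, fun _ _ => rfl⟩
  -- its two local letters
  have hXv : ∀ (v' : TSite d m) (g : TSite d (towerP L m (n + 1)) → W) (F : ℝ), (∀ y, blockCoord (L ^ (n + 1)) m (siteCast (towerP_eq_fineP_pow L m (n + 1)) y) ≠ v' → g y = 0) → (∀ y, ‖g y‖ ≤ F) →
      ∀ y, ‖X g y‖ ≤ Bx * Real.exp (-(κx * tdist m (blockCoord (L ^ (n + 1)) m (siteCast (towerP_eq_fineP_pow L m (n + 1)) y)) v')) * F := by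
    intro v' g F hgv hgF y
    rw [hX]
    exact (HXk' v' (((WL2.equiv ℂ (fun _ : TSite d (towerP L m (n + 1)) => c₀) W)).symm g) F (fun z hz => by rw [Equiv.apply_symm_apply]; exact hgv z hz)
      (fun z => by rw [Equiv.apply_symm_apply]; exact hgF z)).1 y
  have hXg : ∀ (v' : TSite d m) (g : TSite d (towerP L m (n + 1)) → W) (F : ℝ), (∀ y, blockCoord (L ^ (n + 1)) m (siteCast (towerP_eq_fineP_pow L m (n + 1)) y) ≠ v' → g y = 0) → (∀ y, ‖g y‖ ≤ F) →
      ∀ b : Bond d (towerP L m (n + 1)), ‖covDeriv ((η : ℂ))⁻¹ (adTransportW φ U) (X g) b‖ ≤ Bx * Real.exp (-(κx * tdist m (blockCoord (L ^ (n + 1)) m (siteCast (towerP_eq_fineP_pow L m (n + 1)) (bpos b))) v')) * F := by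
    intro v' g F hgv hgF b
    have e : X g = WL2.equiv ℂ (fun _ : TSite d (towerP L m (n + 1)) => c₀) W (GpOfUk L m n φ η U a' (c₁ := c₁) hpos' (LinearMap.adjoint ((WL2.linearEquiv ℂ ℂ (fun _ : TSite d m => c₁)).symm.toLinearMap ∘ₗ QprimeTowerW L m n φ U (c₀ := c₀)) (greenK _ (QGGQk_pos_of_unitary L m n φ c₀ η U c₁ a' τ hτ₂ hφτ hUst hpos') (((WL2.linearEquiv ℂ ℂ (fun _ : TSite d m => c₁)).symm.toLinearMap ∘ₗ QprimeTowerW L m n φ U (c₀ := c₀)) (GpOfUk L m n φ η U a' (c₁ := c₁) hpos' ((WL2.equiv ℂ (fun _ : TSite d (towerP L m (n + 1)) => c₀) W).symm g)))))) := funext (hX g)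
    rw [e, ← equiv_covDerivL2K]
    exact (HXk' v' (((WL2.equiv ℂ (fun _ : TSite d (towerP L m (n + 1)) => c₀) W)).symm g) F (fun z hz => by rw [Equiv.apply_symm_apply]; exact hgv z hz)
      (fun z => by rw [Equiv.apply_symm_apply]; exact hgF z)).2 b
  -- `ν = G′D*f` read on the site functions, its rows from (HLa₀)
  set ν : TSite d (towerP L m (n + 1)) → W := WL2.equiv ℂ (fun _ : TSite d (towerP L m (n + 1)) => c₀) W (GpOfUk L m n φ η U a' (c₁ := c₁) hpos' (covDivL2K ℂ c₀ ((η : ℂ))⁻¹ (adTransportW φ fun bb => (U bb)⁻¹) f)) with hν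
  have hνv : ∀ y, ‖ν y‖ ≤ Ba * F * Real.exp (-(δa * tdist m (blockCoord (L ^ (n + 1)) m (siteCast (towerP_eq_fineP_pow L m (n + 1)) y)) v)) := fun y => by
    have := (HAk y).1; rw [hν]; linarith [this, show Ba * Real.exp (-(δa * tdist m (blockCoord (L ^ (n + 1)) m (siteCast (towerP_eq_fineP_pow L m (n + 1)) y)) v)) * F =
      Ba * F * Real.exp (-(δa * tdist m (blockCoord (L ^ (n + 1)) m (siteCast (towerP_eq_fineP_pow L m (n + 1)) y)) v)) by ring]
  have hνh : ∀ y y', tdist (towerP L m (n + 1)) y y' ≤ ((L ^ (n + 1) : ℕ) : ℝ) →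
      ‖ν y' - ν y‖ ≤ Ba * F * Real.exp (-(δa * tdist m (blockCoord (L ^ (n + 1)) m (siteCast (towerP_eq_fineP_pow L m (n + 1)) y)) v)) * (tdist (towerP L m (n + 1)) y y' / ((L ^ (n + 1) : ℕ) : ℝ)) ^ ε := fun y y' hyy => by
    have := (HAk y).2 y' hyy; rw [hν]
    linarith [this, show Ba * Real.exp (-(δa * tdist m (blockCoord (L ^ (n + 1)) m (siteCast (towerP_eq_fineP_pow L m (n + 1)) y)) v)) * (tdist (towerP L m (n + 1)) y y' / ((L ^ (n + 1) : ℕ) : ℝ)) ^ ε * F =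
      Ba * F * Real.exp (-(δa * tdist m (blockCoord (L ^ (n + 1)) m (siteCast (towerP_eq_fineP_pow L m (n + 1)) y)) v)) * (tdist (towerP L m (n + 1)) y y' / ((L ^ (n + 1) : ℕ) : ℝ)) ^ ε by ring]
  -- the projection step
  have hstep := weightedHolderRows_sub_of_localLetters (L ^ (n + 1)) m φ hφ hφ' hMφ hMφ' (towerP_eq_fineP_pow L m (n + 1)) hm U hη hηK hα hUb hUη
    X hBx hκx hXv hXg ν v hBaF hBaF hδa.le hε1 hνv hνh
  rw [← hδ₂d] at hstep
  obtain ⟨hval, hhol⟩ := hstep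
  -- `ω = R_kν = ν − Xν` on the functions
  have hR : WL2.equiv ℂ (fun _ : TSite d (towerP L m (n + 1)) => c₀) W (RofUk L m n φ η U (GpOfUk L m n φ η U a' (c₁ := c₁) hpos' (covDivL2K ℂ c₀ ((η : ℂ))⁻¹ (adTransportW φ fun bb => (U bb)⁻¹) f))) = ν - X ν := by
    rw [RofUk_eq_formula_of_unitary L m n φ c₀ η U c₁ a' τ hτ₂ hφτ hUst hpos', WL2.equiv_sub, hν]
    congr 1
    funext y
    rw [hX, Equiv.symm_apply_apply]
  set N' : ℝ := Bx * latticeConst d (κx - δ₂) * (Ba * F) with hN'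
  have hK0 : 0 ≤ Bx * latticeConst d (κx - δ₂) := by positivity
  have hmin0 : 0 ≤ min αa αx := (lt_min hαa hαx).le
  have hCN : Ba * F + N' ≤ C * F := by
    rw [hC, hN']
    have h1 : 0 ≤ (d : ℝ) * (Bx * latticeConst d (κx - δ₂) * (Ba * F) + 2 * Mφ * Mφ' * (min αa αx) * (Bx * latticeConst d (κx - δ₂) * (Ba * F))) *
        Real.exp δ₂ := by
      have : 0 ≤ Bx * latticeConst d (κx - δ₂) * (Ba * F) := mul_nonneg hK0 hBaF
      positivity
    nlinarith
  have hCH : Ba * F + d * (N' + 2 * Mφ * Mφ' * α * N') * Real.exp δ₂ ≤ C * F := by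
    rw [hC, hN']
    have h0 : 0 ≤ Bx * latticeConst d (κx - δ₂) * (Ba * F) := mul_nonneg hK0 hBaF
    have h1 : 2 * Mφ * Mφ' * α * (Bx * latticeConst d (κx - δ₂) * (Ba * F)) ≤ 2 * Mφ * Mφ' * (min αa αx) * (Bx * latticeConst d (κx - δ₂) * (Ba * F)) :=
      mul_le_mul_of_nonneg_right (mul_le_mul_of_nonneg_left hαle (by positivity)) h0
    have h2 : 0 ≤ Real.exp δ₂ := (Real.exp_pos _).le
    have h3 := mul_le_mul_of_nonneg_right (mul_le_mul_of_nonneg_left (add_le_add_left h1 (Bx * latticeConst d (κx - δ₂) * (Ba * F))) (Nat.cast_nonneg d)) h2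
    nlinarith [h3]
  refine ⟨?_, fun x' hxx => ?_⟩
  · rw [hR]
    have h1 := hval x
    have hE : 0 ≤ Real.exp (-(δ₂ * tdist m (blockCoord (L ^ (n + 1)) m (siteCast (towerP_eq_fineP_pow L m (n + 1)) x)) v)) := (Real.exp_pos _).le
    calc ‖(ν - X ν) x‖ ≤ (Ba * F + N') * Real.exp (-(δ₂ * tdist m (blockCoord (L ^ (n + 1)) m (siteCast (towerP_eq_fineP_pow L m (n + 1)) x)) v)) := h1
      _ ≤ C * F * Real.exp (-(δ₂ * tdist m (blockCoord (L ^ (n + 1)) m (siteCast (towerP_eq_fineP_pow L m (n + 1)) x)) v)) := mul_le_mul_of_nonneg_right hCN hE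
      _ = C * Real.exp (-(δ₂ * tdist m (blockCoord (L ^ (n + 1)) m (siteCast (towerP_eq_fineP_pow L m (n + 1)) x)) v)) * F := by ring
  · rw [hR]
    have h1 := hhol x x' hxx
    have hE : 0 ≤ Real.exp (-(δ₂ * tdist m (blockCoord (L ^ (n + 1)) m (siteCast (towerP_eq_fineP_pow L m (n + 1)) x)) v)) * (tdist (towerP L m (n + 1)) x x' / ((L ^ (n + 1) : ℕ) : ℝ)) ^ ε :=
      mul_nonneg (Real.exp_pos _).le (Real.rpow_nonneg (div_nonneg (tdist_nonneg _ _ _) (Nat.cast_nonneg _)) ε)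
    calc ‖(ν - X ν) x' - (ν - X ν) x‖
        ≤ (Ba * F + d * (N' + 2 * Mφ * Mφ' * α * N') * Real.exp δ₂) * Real.exp (-(δ₂ * tdist m (blockCoord (L ^ (n + 1)) m (siteCast (towerP_eq_fineP_pow L m (n + 1)) x)) v)) *
          (tdist (towerP L m (n + 1)) x x' / ((L ^ (n + 1) : ℕ) : ℝ)) ^ ε := h1
      _ = (Ba * F + d * (N' + 2 * Mφ * Mφ' * α * N') * Real.exp δ₂) * (Real.exp (-(δ₂ * tdist m (blockCoord (L ^ (n + 1)) m (siteCast (towerP_eq_fineP_pow L m (n + 1)) x)) v)) *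
          (tdist (towerP L m (n + 1)) x x' / ((L ^ (n + 1) : ℕ) : ℝ)) ^ ε) := by ring
      _ ≤ C * F * (Real.exp (-(δ₂ * tdist m (blockCoord (L ^ (n + 1)) m (siteCast (towerP_eq_fineP_pow L m (n + 1)) x)) v)) * (tdist (towerP L m (n + 1)) x x' / ((L ^ (n + 1) : ℕ) : ℝ)) ^ ε) :=
          mul_le_mul_of_nonneg_right hCH hE
      _ = C * Real.exp (-(δ₂ * tdist m (blockCoord (L ^ (n + 1)) m (siteCast (towerP_eq_fineP_pow L m (n + 1)) x)) v)) * (tdist (towerP L m (n + 1)) x x' / ((L ^ (n + 1) : ℕ) : ℝ)) ^ ε * F := by ring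

end Literature.MathematicalPhysics.QuantumFieldTheory.Balaban1983to89.B9Eq3152RkStepHolderLetterExplicit

end
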